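import Literature.AlgebraicGeometry.HodgeTheory.AmpleDivisorClassHardLefschetz
import Literature.AlgebraicGeometry.HodgeTheory.CartierDivisorChernClassRational
import Literature.AlgebraicGeometry.HodgeTheory.ChernCharacterTautologicalPullback
import Literature.AlgebraicGeometry.HodgeTheory.TopHodgeClassesSpannedByPullbacksOfInputs
import Literature.AlgebraicGeometry.HodgeTheory.HyperplaneClassRational
import Literature.AlgebraicGeometry.HodgeTheory.BlochSemiregularSpreadFromSubscheme
import Literature.AlgebraicGeometry.Deligne1982.SplitWeilTypeCMIsometry
import HarnessLib

/-!
# The class of an AMPLE divisor is a hyperplane class: every non-zero rational point of the line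
# `ℂ·c₁(𝒪_X(Θ))` is `e^* a` for a projective embedding `e : X ↪ ℙᴺ` and a rational `a ≠ 0` — hence has a
# KÄHLER REAL MULTIPLE (Voisin I Thm. 7.10, in the tree's two polarisation currencies; no Kodaira needed)

Family `hodge`, layer `Literature/AlgebraicGeometry/HodgeTheory`. The tree carries the polarisation of a smooth
projective complex variety in THREE forms (module docstring of `KodairaEmbeddingHyperplaneClass`): (1) the divisor LINE
`Motives.IsDivisorClassLineOf n X Θ θ` / `AbelianVariety.IsPolarizationClassOf Θ θ` (`θ ∈ ℚˣ·[Θ]`, `Θ` an ample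
Cartier divisor — the ample-line clause of the ring-2 anchor predicates); (2) the HYPERPLANE CLASS `e^* a` of a projective
embedding `e : X ↪ ℙᴺ` (`Motives.ProjectiveEmbedding X`, `a ∈ H²(ℙᴺ(ℂ); ℂ)` rational `≠ 0` — the format of the
Weil-type facts, of `Motives.IsHyperbolicWeilType`, of André's Lemme 6.3.3 as typed and of the ring-2 one-anchor node
`OneHyperbolicWeilCarrier`); (3) a rational class A NON-ZERO REAL MULTIPLE OF WHICH IS KÄHLER (Deligne's Thm. 4.8 as
typed, `Kodaira1954_rationalKaehlerClass_eq_hyperplaneClass`). The passages (2) ⟹ (3)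
(`Deligne1982.exists_isKaehlerClass_smul_map_ι`) and (1) ⟹ hard Lefschetz (`AmpleDivisorClassHardLefschetz`) are
theorems of the tree; (3) ⟹ (2) is Kodaira's embedding theorem, a NAMED FACT. This file PROVES the passage
**(1) ⟹ (2)** — and hence (1) ⟹ (3) — WITHOUT Kodaira, for the class of an ample DIVISOR (in print: Hartshorne II
Thm. 7.6 «some `q•Θ` is very ample, i.e. `𝒪_X(qΘ) ≅ ι^*𝒪(1)` for an immersion `ι`», with Voisin I Thm. 7.10 /
Lemma 3.16 «`c₁(ι^*𝒪(1)) = ι^*c₁(𝒪(1))` is the restricted Fubini–Study class» and Thm. 7.14 «`H²(ℙᴺ, ℤ) = ℤ·c₁(𝒪(1))`»):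

* `exists_projectiveEmbedding_map_eq_of_isAmple_of_isDivisorClassLineOf` — **for `X` smooth projective, `Θ` ample and
  `θ` a non-zero RATIONAL class on the line `ℂ·ch₁ᴹ(𝒪_X(Θ))`, there are a projective embedding `e : X ↪ ℙᴺ` and a
  rational `a ≠ 0` in `H²(ℙᴺ(ℂ); ℂ)` with `e^* a = θ`.** Proof on the real carrier: `q•Θ ∼ H_ι` for a closed immersion
  `ι : X ⟶ ℙᴺ` (`CartierDivisor.IsAmple.exists_pos_smul_linEquiv_hyperplaneDivisor`), so `q·ch(Θ) = ch(H_ι) = -c_ι`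
  (`CartierCocycleChernCalculus`), `c_ι = ch₁ᴹ(𝒪(-1)|_X) = ch₁ᴹ((ι^an)⁻¹𝒪_{ℙᴺ}(-1)) = r • ι^* c_{ℙᴺ}`
  (`tautologicalBundle_pullback_anMap`, `HodgeModel.exists_chernCharacter_tautologicalBundle_pullback_eq_smul_map` — Kobayashi's
  naturality axiom up to the models' normalisation scalar `r ≠ 0`), `c_{ℙᴺ} = z • r₀` with `r₀` rational
  (`exists_isRationalClass_forall_eq_smul_projectiveSpace`); hence `θ = w • ι^* r₀` for ONE complex `w`, and since `θ`
  and `ι^* r₀` are RATIONAL and `θ ≠ 0`, `w ∈ ℚ` (`IsRationalClass.exists_rat_eq_of_smul`: `H²(X; ℚ) ⊗ ℂ ↪ H²(X; ℂ)`);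
  take `a := w • r₀`. The complex normalisation scalars of the Hodge models (`CartierDivisorChernClassRational`: `ch₁ᴹ` is
  rational only up to ONE `λ_M ∈ ℂˣ`) are thus eliminated by the rationality of `θ`, not by a reality statement about
  `λ_M` (which the tree's carrier does not give);
* `exists_isKaehlerClass_smul_of_isAmple_of_isDivisorClassLineOf` — **hence such a `θ` has a Kähler REAL multiple**
  (`∃ s : ℝ, s ≠ 0 ∧ IsKaehlerClass n X (s • θ)`; Voisin I Thm. 7.10: `c₁` of an ample line bundle is a positive
  multiple of a Kähler class), by `Deligne1982.exists_isKaehlerClass_smul_map_ι`;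
* consequently, on ample lines the conclusion of the named fact `Kodaira1954_rationalKaehlerClass_eq_hyperplaneClass`
  (`KodairaEmbeddingHyperplaneClass`) holds UNCONDITIONALLY and its Kähler-multiple hypothesis is a theorem (the fact
  itself, for arbitrary rational classes with a Kähler multiple, stays a fact; it is not used here);
* abelian varieties (`namespace Literature.AlgebraicGeometry.Motives.AbelianVariety`):
  `IsPolarizationClassOf.exists_projectiveEmbedding_map_eq`, `IsPolarizationClassOf.exists_isKaehlerClass_smul`,
  `IsPrincipalPolarizationClass.exists_projectiveEmbedding_map_eq`, `IsPrincipalPolarizationClass.exists_isKaehlerClass_smul`,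
  and the «ample-line clause» forms `exists_projectiveEmbedding_map_eq_of_ampleLine` /
  `exists_isKaehlerClass_smul_of_ampleLine` consumed verbatim by the ring-2 one-anchor junction
  (`∃ H, H.IsAmple ∧ A.IsPolarizationClassOf H θ ⟹ ∃ e a, IsRationalClass a ∧ a ≠ 0 ∧ e^*a = θ`).

Everything is proved; no definition and no named fact is introduced. NOT here: positivity / the sign of `s` (the
tree's `c₁` on the real carrier does not see it), the line bundle `𝒪_X(Θ)` as an invertible sheaf, Kodaira's theorem.

## References

* [Hartshorne1977] R. Hartshorne, *Algebraic Geometry*, GTM 52, II Thm. 7.6 (p. 154), II Thm. 7.1.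
* [VoisinHodgeI2002] C. Voisin, *Hodge Theory and Complex Algebraic Geometry I* (CUP 2002), §3.3.2 Lemma 3.16,
  §7.1.2 Thm. 7.10, §7.1.3 Def. 7.8, §7.2.1 Thm. 7.14, Thm. 11.33.
* [Lange2023AbelianVarietiesComplex] H. Lange, *Abelian Varieties over the Complex Numbers* (2023), §2.1.1 (p. 68).
* [Kobayashi1987] S. Kobayashi, *Differential Geometry of Complex Vector Bundles*, Ch. II §1 Axiom 2.
* [HatcherAT2002] A. Hatcher, *Algebraic Topology*, §3.1 Thm. 3.2, Thm. 3.19.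
* Tree: `AmpleDivisorClassHardLefschetz`, `CartierDivisorChernClassRational`, `ChernCharacterTautologicalPullback`,
  `TopHodgeClassesSpannedByPullbacksOfInputs` (`tautologicalBundle_pullback_anMap`), `HyperplaneClassRational`,
  `BlochSemiregularSpreadFromSubscheme` (`IsRationalClass.exists_rat_eq_of_smul`), `Deligne1982/SplitWeilTypeCMIsometry`
  (`exists_isKaehlerClass_smul_map_ι`).
-/

noncomputable section

open scoped Manifold ContDiff
open CategoryTheory AlgebraicGeometry

namespace Literature.AlgebraicGeometry.HodgeTheory

section HodgeTheory

open Literature.AlgebraicTopology.SingularHomology Literature.Geometry.Kaehler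
open Literature.NumberTheory.Transcendental
open Literature.AlgebraicGeometry.Motives (projectiveSpace IsSmoothProjective ProjectiveEmbedding CartierDivisor
  IsDivisorClassLineOf)
open Literature.AlgebraicGeometry.Motives.AnalytificationKaehler (tautologicalBundle)

variable {n : ℕ} {X : Motives.SchemeOver ℂ}

/-- The tautological cocycle `𝒪(-1)|_{X^an}` of a closed immersion, read on a Hodge model, depends only on the morphism
(not on the proof that it is a closed immersion): equal morphisms give equal cocycles. [folklore] -/
private theorem HodgeModel.tautologicalBundle_congr (A : HodgeModel n X) {N : ℕ} {ι ι' : X ⟶ projectiveSpace N ℂ}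
    [IsClosedImmersion ι.left] [IsClosedImmersion ι'.left] (h : ι = ι') :
    tautologicalBundle ι A.isAnalytification = tautologicalBundle ι' A.isAnalytification := by
  subst h
  rfl

/-- **The class of an ample divisor is a hyperplane class (Hartshorne II 7.6 + Voisin I Thm. 7.10 / Lemma 3.16, on the
real carrier).** For `X` smooth projective of dimension `n`, `Θ` an AMPLE Cartier divisor and `θ ∈ H²(X(ℂ); ℂ)` a non-zero
RATIONAL class on the line `ℂ·ch₁ᴹ(𝒪_X(Θ))` (`IsDivisorClassLineOf n X Θ θ`), there are a projective embedding
`e : X ↪ ℙᴺ` and a non-zero rational class `a ∈ H²(ℙᴺ(ℂ); ℂ)` with `e^* a = θ`: `q•Θ ∼ H_ι` (`q ≥ 1`, `ι` a closed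
immersion), `q·ch(Θ) = ch(H_ι) = -c_ι`, `c_ι = ch₁((ι^an)⁻¹𝒪_{ℙᴺ}(-1)) = r • ι^*c_{ℙᴺ}`, `c_{ℙᴺ} = z • r₀` with `r₀`
rational, so `θ = w • ι^* r₀`; `θ` and `ι^* r₀` being rational and `θ ≠ 0`, `w` is rational (module docstring).
[cite: Hartshorne1977, II Thm. 7.6 (p. 154)] [cite: VoisinHodgeI2002, §3.3.2 Lemma 3.16, §7.1.2 Thm. 7.10 and §7.2.1 Thm. 7.14] -/
theorem exists_projectiveEmbedding_map_eq_of_isAmple_of_isDivisorClassLineOf [IsIntegral X.left]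
    (hX : IsSmoothProjective n X) {Θ : CartierDivisor X.left} (hΘ : Θ.IsAmple) {θ : complexBetti X 2}
    (hrat : IsRationalClass θ) (hne : θ ≠ 0) (hline : IsDivisorClassLineOf n X Θ θ) :
    ∃ (e : ProjectiveEmbedding X) (a : complexBetti (projectiveSpace e.n ℂ) 2),
      IsRationalClass a ∧ a ≠ 0 ∧ complexBetti.map e.ι 2 a = θ := by
  obtain ⟨M, c, hθ⟩ := hline
  haveI : IsProper X.hom := Motives.IsSmoothProjective.isProper_holds hX
  -- Hartshorne II 7.6: `q • Θ ∼ H_ι` for a closed immersion `ι : X ⟶ ℙᴺ`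
  obtain ⟨q, hq, N, ι, hι, a₀, ha₀, hlin⟩ := hΘ.exists_pos_smul_linEquiv_hyperplaneDivisor
  haveI := hι
  -- `q • ch(Θ) = ch(H_ι) = -c_ι`
  have h1 := M.chernCharacter_cartierDivisorCocycle_eq_of_linEquiv hlin
  rw [M.chernCharacter_cartierDivisorCocycle_smul, M.chernCharacter_cartierDivisorCocycle_divisor_eq_neg ι a₀ ha₀]
    at h1
  have hq0 : (q : ℂ) ≠ 0 := by exact_mod_cast hq.ne'
  -- a Hodge model `B` of `ℙᴺ` and the functoriality of `ch₁(𝒪(-1))` along `ι` (one scalar `r ≠ 0`)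
  have hPN : IsSmoothProjective N (projectiveSpace N ℂ) := isSmoothProjective_projectiveSpace' N
  haveI hid : IsClosedImmersion (𝟙 (projectiveSpace N ℂ) : projectiveSpace N ℂ ⟶ _).left :=
    show IsClosedImmersion (𝟙 (projectiveSpace N ℂ).left) from inferInstance
  haveI hιc : IsClosedImmersion (ι ≫ 𝟙 (projectiveSpace N ℂ)).left := by
    rw [Over.comp_left]; infer_instance
  have hnN : n ≤ N := le_of_isClosedImmersion_projectiveSpace hX ι
  obtain ⟨B⟩ := (nonempty_hodgeModel_holds (n := N) (X := projectiveSpace N ℂ)).nonempty hPN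
  have hpb := tautologicalBundle_pullback_anMap M B ι (𝟙 (projectiveSpace N ℂ)) hX hPN
  obtain ⟨r, hr, hrψ⟩ := HodgeModel.exists_chernCharacter_tautologicalBundle_pullback_eq_smul_map hX M B hnN
  have h2 := hrψ ι
  rw [hpb, M.tautologicalBundle_congr (Category.comp_id ι)] at h2
  -- `H²(ℙᴺ(ℂ); ℂ) = ℂ · r₀`, `r₀` rational
  obtain ⟨r₀, hr₀, hgen⟩ := exists_isRationalClass_forall_eq_smul_projectiveSpace N
  obtain ⟨z, hz⟩ := hgen (B.chernCharacter
    (tautologicalBundle (𝟙 (projectiveSpace N ℂ)) B.isAnalytification) 1)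
  -- `θ = w • ι^* r₀`
  set w : ℂ := c * (-(q : ℂ)⁻¹) * r * z with hw
  have hθw : θ = w • complexBetti.map ι 2 r₀ := by
    have e1 : (M.chernCharacter (cartierDivisorCocycle M.isAnalytification Θ) 1 : complexBetti X 2) =
        (q : ℂ)⁻¹ • ((q : ℂ) • M.chernCharacter (cartierDivisorCocycle M.isAnalytification Θ) 1) := by
      rw [smul_smul, inv_mul_cancel₀ hq0, one_smul]
    rw [hθ, e1, h1, smul_neg, ← neg_smul, h2, hz, map_smul, smul_smul, smul_smul, smul_smul, hw]
  -- `ι^* r₀` is rational and non-zero, so `w ∈ ℚ`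
  have hρ : IsRationalClass (complexBetti.map ι 2 r₀) := hr₀.pullback _
  have hρ0 : complexBetti.map ι 2 r₀ ≠ 0 := by
    intro h0
    exact hne (by rw [hθw, h0, smul_zero])
  obtain ⟨t, ht⟩ := hρ.exists_rat_eq_of_smul hρ0 (c := w) (by rw [← hθw]; exact hrat)
  refine ⟨⟨N, ι, hι⟩, (t : ℂ) • r₀, hr₀.smul t, ?_, ?_⟩
  · intro h0
    apply hne
    rw [hθw, ht, ← map_smul, h0, map_zero]
  · change complexBetti.map ι 2 ((t : ℂ) • r₀) = θ
    rw [map_smul, ← ht, ← hθw]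

/-- **The class of an ample divisor has a Kähler real multiple (Voisin I Thm. 7.10, on the real carrier).** For `X`
smooth projective of dimension `n`, `Θ` ample and `θ` a non-zero rational class on the line `ℂ·c₁(𝒪_X(Θ))`, some
`s • θ` with `s ∈ ℝˣ` is a Kähler class (`IsKaehlerClass n X`): `θ = e^* a` by the previous theorem and a hyperplane
class is a non-zero real multiple of the class of the restricted Fubini–Study metric
(`Deligne1982.exists_isKaehlerClass_smul_map_ι`). In print `c₁(L)` of an ample `L` is itself positive; the sign of `s`
is not recorded (module docstring). [cite: VoisinHodgeI2002, §7.1.2 Thm. 7.10 and §3.3.2 Lemma 3.16]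
[cite: Hartshorne1977, II Thm. 7.6 (p. 154)] -/
theorem exists_isKaehlerClass_smul_of_isAmple_of_isDivisorClassLineOf [IsIntegral X.left]
    (hX : IsSmoothProjective n X) {Θ : CartierDivisor X.left} (hΘ : Θ.IsAmple) {θ : complexBetti X 2}
    (hrat : IsRationalClass θ) (hne : θ ≠ 0) (hline : IsDivisorClassLineOf n X Θ θ) :
    ∃ s : ℝ, s ≠ 0 ∧ IsKaehlerClass n X ((s : ℂ) • θ) := by
  -- `dim X ≥ 1` (else `H² = 0`)
  have hn : 1 ≤ n := by
    by_contra h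
    have hn0 : n = 0 := by omega
    subst hn0
    haveI : Subsingleton (complexBetti X (2 * 1)) :=
      Motives.ComplexPoints.subsingleton_singularCohomology_of_lt hX ℂ (k := 2 * 1) (by omega)
    exact hne (Subsingleton.elim _ _)
  obtain ⟨m, rfl⟩ : ∃ m, n = m + 1 := ⟨n - 1, by omega⟩
  obtain ⟨e, a, ha, ha0, hea⟩ := exists_projectiveEmbedding_map_eq_of_isAmple_of_isDivisorClassLineOf hX hΘ hrat hne hline
  rw [← hea]
  exact Deligne1982.exists_isKaehlerClass_smul_map_ι hX e ha ha0

end HodgeTheory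

end Literature.AlgebraicGeometry.HodgeTheory

/-! ### Abelian varieties: polarisation classes of ample divisors are hyperplane classes with Kähler real multiples -/

namespace Literature.AlgebraicGeometry.Motives

namespace AbelianVariety

open Literature.AlgebraicGeometry.HodgeTheory Literature.Geometry.Kaehler
open Literature.AlgebraicTopology.SingularHomology

variable {A : AbelianVariety ℂ}

/-- **A polarisation class `θ ∈ ℚˣ·[Θ]` of an AMPLE divisor `Θ` on a complex abelian variety is a hyperplane class**:
`θ = e^* a` for a projective embedding `e : A ↪ ℙᴺ` and a rational `a ≠ 0` (Lange §2.1.1 / §4.5: a polarisation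
`H = c₁(L)`, `L` ample, and `L^{⊗3}` is very ample; here via Hartshorne II 7.6 on the real carrier).
[cite: Lange2023AbelianVarietiesComplex, §2.1.1 (p. 68)] [cite: Hartshorne1977, II Thm. 7.6 (p. 154)] -/
theorem IsPolarizationClassOf.exists_projectiveEmbedding_map_eq {Θ : CartierDivisor A.X.left} {θ : complexBetti A.X 2}
    (h : A.IsPolarizationClassOf Θ θ) (hΘ : Θ.IsAmple) :
    ∃ (e : ProjectiveEmbedding A.X) (a : complexBetti (projectiveSpace e.n ℂ) 2),
      IsRationalClass a ∧ a ≠ 0 ∧ complexBetti.map e.ι 2 a = θ :=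
  exists_projectiveEmbedding_map_eq_of_isAmple_of_isDivisorClassLineOf isSmoothProjective_holds hΘ h.isRationalClass
    h.ne_zero h.isDivisorClassLineOf

/-- **A polarisation class of an ample divisor on a complex abelian variety has a Kähler real multiple**
(`∃ s ∈ ℝˣ, IsKaehlerClass (dim A) A (s • θ)`; Voisin I Thm. 7.10). [cite: VoisinHodgeI2002, §7.1.2 Thm. 7.10]
[cite: Lange2023AbelianVarietiesComplex, §2.1.1 (p. 68)] -/
theorem IsPolarizationClassOf.exists_isKaehlerClass_smul {Θ : CartierDivisor A.X.left} {θ : complexBetti A.X 2}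
    (h : A.IsPolarizationClassOf Θ θ) (hΘ : Θ.IsAmple) :
    ∃ s : ℝ, s ≠ 0 ∧ IsKaehlerClass A.dim A.X ((s : ℂ) • θ) :=
  exists_isKaehlerClass_smul_of_isAmple_of_isDivisorClassLineOf isSmoothProjective_holds hΘ h.isRationalClass h.ne_zero
    h.isDivisorClassLineOf

/-- **A principal polarisation class is a hyperplane class** (`Θ` principal ⟹ ample). [cite: Lange2023AbelianVarietiesComplex, §2.1.1 (p. 68)]
[cite: Hartshorne1977, II Thm. 7.6 (p. 154)] -/
theorem IsPrincipalPolarizationClass.exists_projectiveEmbedding_map_eq {θ : complexBetti A.X 2}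
    (h : A.IsPrincipalPolarizationClass θ) :
    ∃ (e : ProjectiveEmbedding A.X) (a : complexBetti (projectiveSpace e.n ℂ) 2),
      IsRationalClass a ∧ a ≠ 0 ∧ complexBetti.map e.ι 2 a = θ := by
  obtain ⟨Θ, hP, hθ⟩ := h
  exact hθ.exists_projectiveEmbedding_map_eq hP.isAmple

/-- **A principal polarisation class has a Kähler real multiple.** [cite: VoisinHodgeI2002, §7.1.2 Thm. 7.10]
[cite: Lange2023AbelianVarietiesComplex, §2.1.1 (p. 68)] -/
theorem IsPrincipalPolarizationClass.exists_isKaehlerClass_smul {θ : complexBetti A.X 2}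
    (h : A.IsPrincipalPolarizationClass θ) : ∃ s : ℝ, s ≠ 0 ∧ IsKaehlerClass A.dim A.X ((s : ℂ) • θ) := by
  obtain ⟨Θ, hP, hθ⟩ := h
  exact hθ.exists_isKaehlerClass_smul hP.isAmple

variable (A) in
/-- **The «ample-line clause» gives the hyperplane-class pin**: if `θ` is a polarisation class of SOME ample divisor of
`A` (`∃ H, H.IsAmple ∧ A.IsPolarizationClassOf H θ` — the clause carried by the ring-2 anchor predicates), then
`θ = e^* a` with `a` rational `≠ 0` — the pin consumed by the one-anchor Weil-carrier node. [cite: Hartshorne1977, II Thm. 7.6 (p. 154)]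
[cite: Lange2023AbelianVarietiesComplex, §2.1.1 (p. 68)] -/
theorem exists_projectiveEmbedding_map_eq_of_ampleLine {θ : complexBetti A.X 2}
    (hamp : ∃ H : CartierDivisor A.X.left, H.IsAmple ∧ A.IsPolarizationClassOf H θ) :
    ∃ (e : ProjectiveEmbedding A.X) (a : complexBetti (projectiveSpace e.n ℂ) 2),
      IsRationalClass a ∧ a ≠ 0 ∧ complexBetti.map e.ι 2 a = θ := by
  obtain ⟨H, hH, hθ⟩ := hamp
  exact hθ.exists_projectiveEmbedding_map_eq hH

variable (A) in
/-- **The «ample-line clause» gives a Kähler real multiple** (Voisin I Thm. 7.10). [cite: VoisinHodgeI2002, §7.1.2 Thm. 7.10]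
[cite: Lange2023AbelianVarietiesComplex, §2.1.1 (p. 68)] -/
theorem exists_isKaehlerClass_smul_of_ampleLine {θ : complexBetti A.X 2}
    (hamp : ∃ H : CartierDivisor A.X.left, H.IsAmple ∧ A.IsPolarizationClassOf H θ) :
    ∃ s : ℝ, s ≠ 0 ∧ IsKaehlerClass A.dim A.X ((s : ℂ) • θ) := by
  obtain ⟨H, hH, hθ⟩ := hamp
  exact hθ.exists_isKaehlerClass_smul hH

end AbelianVariety

end Literature.AlgebraicGeometry.Motives

end
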